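import Literature.NumberTheory.IwasawaTheory.ClassicalMuVanishesKurodaTower
import Literature.NumberTheory.SerreUniformity.Statement
import Mathlib.GroupTheory.Perm.Cycle.Type
import HarnessLib

set_option autoImplicit false

/-!
# `μ = 0` for `ℚ(E[3])_cyc` from a non-split-Cartan mod-3 image: the bridge from a faithful matrix representation
# `Gal(L/ℚ) ↪ M₂(𝔽₃)` onto `C_ns⁺(3) ≅ SD₁₆` to the semidihedral census forms

Topic `NumberTheory/IwasawaTheory` (namespace = path).  THEOREM-ONLY file (no definition, no named fact, no `sorry`); literature
seat `bsd-potss-conjA-anchor` g11 (supports stmt-BirchSwinnertonDyer-19386 / 19413; closes nothing).  Companion of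
`ClassicalMuVanishesSplitCartanImage.lean`, in the vocabulary of `SerreUniformity.nonsplitCartanNormalizer ε` /
`HasModPImageEqNonsplitCartanNormalizer` (matrices `(a εb; b a)`, `(a −εb; b −a)` over `𝔽₃`, `ε` a non-square, i.e. `ε = −1`):
* `classicalMuVanishes_of_isCyclotomic_of_nonsplitCartanNormalizer_three` — `ρ : Gal(L/ℚ) →* M₂(𝔽₃)` INJECTIVE with values in
  `C_ns⁺(ε)` and ONTO it, `K ⊆ L` of degree `8` fixed by some `s` with `ρ s ≠ ±1` (`K = ℚ(P)`), `K' ⊆ L` of degree `4` fixed by `s`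
  and by the `g` with `ρ g = −1` (`K' = ℚ(x(P))`): under `ferreroWashington1979_classicalMuVanishes` ALONE, «`μ = 0` for every
  cyclotomic `ℤ_3`-extension of `K` and of `K'`» ⇒ the same for `L` (`…_semidihedral_kuroda_rat`);
* `classicalMuVanishes_of_isCyclotomic_of_nonsplitCartanNormalizer_three'` — the same from `K = ℚ(P)` alone, paying Iwasawa's growth
  theorem (`…_semidihedral_rat`); `…_fixedField` / `…_fixedField'` — the forms with the fields GIVEN as `L^{⟨s⟩}`, `L^{⟨s,z⟩}`
  (`s` an involution with `ρ s ≠ ±1`, `ρ z = −1`; no degree hypotheses), fed by the `ℚ(E[3])`-level statements.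
Group facts (by `decide` on the sixteen matrices): `R = (1 2; 1 1)` (multiplication by `1+i` on `𝔽₉ = 𝔽₃(i)`) has `R⁴ = −1`; commutators
of `C_ns⁺(3)` lie in `{±1, ±R²}`; orders divide `8`; the involutions `≠ ±1` are four «reflections» `S`, each with `S R S = R³`.

References: [Serre1972, §2.2]; [FurioLombardo2023, (1.1)]; [Lemmermeyer1994, §1]; [Washington1997, §7.5, §13.1].
-/

noncomputable section

open scoped NumberField

open Field IntermediateField Literature.NumberTheory.EllipticCurves Literature.NumberTheory.SerreUniformity

namespace Literature.NumberTheory.IwasawaTheory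

/-! ### §0 Finite facts about `C_ns⁺(3)` (`ε = −1 = 2`), by `decide` -/

section Matrices

/-- `C_ns(3)` is abelian. [folklore] -/
private theorem cc_comm : ∀ a b a' b' : ZMod 3,
    (!![a, 2 * b; b, a] : Matrix (Fin 2) (Fin 2) (ZMod 3)) * !![a', 2 * b'; b', a'] = !![a', 2 * b'; b', a'] * !![a, 2 * b; b, a] := by
  decide

/-- Commutators `[C, N]` of `C_ns⁺(3)` lie in `{±1, ±R²}`, `R² = (0 1; 2 0)`. [folklore] -/
private theorem cn_rel : ∀ a b a' b' : ZMod 3, (a, b) ≠ (0, 0) → (a', b') ≠ (0, 0) →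
    (!![a, 2 * b; b, a] : Matrix (Fin 2) (Fin 2) (ZMod 3)) * !![a', -(2 * b'); b', -a'] =
        !![a', -(2 * b'); b', -a'] * !![a, 2 * b; b, a] ∨
      (!![a, 2 * b; b, a] : Matrix (Fin 2) (Fin 2) (ZMod 3)) * !![a', -(2 * b'); b', -a'] =
        -(!![a', -(2 * b'); b', -a'] * !![a, 2 * b; b, a]) ∨
      (!![a, 2 * b; b, a] : Matrix (Fin 2) (Fin 2) (ZMod 3)) * !![a', -(2 * b'); b', -a'] =
        !![0, 1; 2, 0] * (!![a', -(2 * b'); b', -a'] * !![a, 2 * b; b, a]) ∨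
      (!![a, 2 * b; b, a] : Matrix (Fin 2) (Fin 2) (ZMod 3)) * !![a', -(2 * b'); b', -a'] =
        -(!![0, 1; 2, 0] * (!![a', -(2 * b'); b', -a'] * !![a, 2 * b; b, a])) := by
  decide

/-- Commutators `[N, C]` of `C_ns⁺(3)` lie in `{±1, ±R²}`. [folklore] -/
private theorem nc_rel : ∀ a b a' b' : ZMod 3, (a, b) ≠ (0, 0) → (a', b') ≠ (0, 0) →
    (!![a, -(2 * b); b, -a] : Matrix (Fin 2) (Fin 2) (ZMod 3)) * !![a', 2 * b'; b', a'] =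
        !![a', 2 * b'; b', a'] * !![a, -(2 * b); b, -a] ∨
      (!![a, -(2 * b); b, -a] : Matrix (Fin 2) (Fin 2) (ZMod 3)) * !![a', 2 * b'; b', a'] =
        -(!![a', 2 * b'; b', a'] * !![a, -(2 * b); b, -a]) ∨
      (!![a, -(2 * b); b, -a] : Matrix (Fin 2) (Fin 2) (ZMod 3)) * !![a', 2 * b'; b', a'] =
        !![0, 1; 2, 0] * (!![a', 2 * b'; b', a'] * !![a, -(2 * b); b, -a]) ∨
      (!![a, -(2 * b); b, -a] : Matrix (Fin 2) (Fin 2) (ZMod 3)) * !![a', 2 * b'; b', a'] =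
        -(!![0, 1; 2, 0] * (!![a', 2 * b'; b', a'] * !![a, -(2 * b); b, -a])) := by
  decide

/-- Commutators `[N, N']` of `C_ns⁺(3)` lie in `{±1, ±R²}`. [folklore] -/
private theorem nn_rel : ∀ a b a' b' : ZMod 3, (a, b) ≠ (0, 0) → (a', b') ≠ (0, 0) →
    (!![a, -(2 * b); b, -a] : Matrix (Fin 2) (Fin 2) (ZMod 3)) * !![a', -(2 * b'); b', -a'] =
        !![a', -(2 * b'); b', -a'] * !![a, -(2 * b); b, -a] ∨
      (!![a, -(2 * b); b, -a] : Matrix (Fin 2) (Fin 2) (ZMod 3)) * !![a', -(2 * b'); b', -a'] =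
        -(!![a', -(2 * b'); b', -a'] * !![a, -(2 * b); b, -a]) ∨
      (!![a, -(2 * b); b, -a] : Matrix (Fin 2) (Fin 2) (ZMod 3)) * !![a', -(2 * b'); b', -a'] =
        !![0, 1; 2, 0] * (!![a', -(2 * b'); b', -a'] * !![a, -(2 * b); b, -a]) ∨
      (!![a, -(2 * b); b, -a] : Matrix (Fin 2) (Fin 2) (ZMod 3)) * !![a', -(2 * b'); b', -a'] =
        -(!![0, 1; 2, 0] * (!![a', -(2 * b'); b', -a'] * !![a, -(2 * b); b, -a])) := by
  decide

/-- In `C_ns⁺(3)`, `AC = D·CA` with `D ∈ {1, −1, R², −R²}`. [folklore] -/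
private theorem mul_eq_of_mem {A C : Matrix (Fin 2) (Fin 2) (ZMod 3)} (hA : A ∈ nonsplitCartanNormalizer (2 : ZMod 3))
    (hC : C ∈ nonsplitCartanNormalizer (2 : ZMod 3)) :
    A * C = C * A ∨ A * C = -(C * A) ∨ A * C = !![0, 1; 2, 0] * (C * A) ∨ A * C = -(!![0, 1; 2, 0] * (C * A)) := by
  obtain ⟨a, b, hab, rfl | rfl⟩ := hA <;> obtain ⟨a', b', hab', rfl | rfl⟩ := hC
  · exact Or.inl (cc_comm a b a' b')
  · exact cn_rel a b a' b' hab hab'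
  · exact nc_rel a b a' b' hab hab'
  · exact nn_rel a b a' b' hab hab'

/-- Orders in `C_ns(3) ≅ 𝔽₉ˣ` divide `8`. [folklore] -/
private theorem c_pow_eight : ∀ a b : ZMod 3, (a, b) ≠ (0, 0) →
    (!![a, 2 * b; b, a] : Matrix (Fin 2) (Fin 2) (ZMod 3)) ^ 8 = 1 := by
  decide

/-- Orders in `C_ns⁺(3) ∖ C_ns(3)` divide `8` (indeed `4`). [folklore] -/
private theorem n_pow_eight : ∀ a b : ZMod 3, (a, b) ≠ (0, 0) →
    (!![a, -(2 * b); b, -a] : Matrix (Fin 2) (Fin 2) (ZMod 3)) ^ 8 = 1 := by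
  decide

/-- Every element of `C_ns⁺(3)` has order dividing `8`. [folklore] -/
private theorem pow_eight_eq_one_of_mem {A : Matrix (Fin 2) (Fin 2) (ZMod 3)}
    (hA : A ∈ nonsplitCartanNormalizer (2 : ZMod 3)) : A ^ 8 = 1 := by
  obtain ⟨a, b, hab, rfl | rfl⟩ := hA
  exacts [c_pow_eight a b hab, n_pow_eight a b hab]

/-- The elements of `C_ns(3)` among the sixteen matrices of `C_ns⁺(3)`. [folklore] -/
private theorem c_mem_sixteen : ∀ a b : ZMod 3, (a, b) ≠ (0, 0) → (!![a, 2 * b; b, a] : Matrix (Fin 2) (Fin 2) (ZMod 3)) ∈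
    ({1, -1, !![0, 2; 1, 0], !![0, 1; 2, 0], !![1, 2; 1, 1], !![1, 1; 2, 1], !![2, 2; 1, 2], !![2, 1; 2, 2],
      !![1, 0; 0, 2], !![2, 0; 0, 1], !![0, 1; 1, 0], !![0, 2; 2, 0], !![1, 1; 1, 2], !![1, 2; 2, 2], !![2, 1; 1, 1],
      !![2, 2; 2, 1]} : Finset (Matrix (Fin 2) (Fin 2) (ZMod 3))) := by
  decide

/-- The elements of `C_ns⁺(3) ∖ C_ns(3)` among the sixteen matrices of `C_ns⁺(3)`. [folklore] -/
private theorem n_mem_sixteen : ∀ a b : ZMod 3, (a, b) ≠ (0, 0) →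
    (!![a, -(2 * b); b, -a] : Matrix (Fin 2) (Fin 2) (ZMod 3)) ∈
    ({1, -1, !![0, 2; 1, 0], !![0, 1; 2, 0], !![1, 2; 1, 1], !![1, 1; 2, 1], !![2, 2; 1, 2], !![2, 1; 2, 2],
      !![1, 0; 0, 2], !![2, 0; 0, 1], !![0, 1; 1, 0], !![0, 2; 2, 0], !![1, 1; 1, 2], !![1, 2; 2, 2], !![2, 1; 1, 1],
      !![2, 2; 2, 1]} : Finset (Matrix (Fin 2) (Fin 2) (ZMod 3))) := by
  decide

/-- `#C_ns⁺(3) = 16`: a group with a faithful representation into `C_ns⁺(3)` has at most `16` elements. [folklore] -/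
private theorem natCard_le_sixteen {G : Type*} [Group G] [Finite G] (ρ : G →* Matrix (Fin 2) (Fin 2) (ZMod 3))
    (hρ : Function.Injective ρ) (himg : ∀ g, ρ g ∈ nonsplitCartanNormalizer (2 : ZMod 3)) : Nat.card G ≤ 16 := by
  classical
  haveI := Fintype.ofFinite G
  have hmaps : Set.MapsTo ρ ↑(Finset.univ : Finset G)
      ↑({1, -1, !![0, 2; 1, 0], !![0, 1; 2, 0], !![1, 2; 1, 1], !![1, 1; 2, 1], !![2, 2; 1, 2], !![2, 1; 2, 2],
        !![1, 0; 0, 2], !![2, 0; 0, 1], !![0, 1; 1, 0], !![0, 2; 2, 0], !![1, 1; 1, 2], !![1, 2; 2, 2], !![2, 1; 1, 1],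
        !![2, 2; 2, 1]} : Finset (Matrix (Fin 2) (Fin 2) (ZMod 3))) := by
    intro g _
    rw [Finset.mem_coe]
    obtain ⟨a, b, hab, h | h⟩ := himg g
    · rw [h]; exact c_mem_sixteen a b hab
    · rw [h]; exact n_mem_sixteen a b hab
  have h1 := Finset.card_le_card_of_injOn ρ hmaps hρ.injOn
  have h2 : ({1, -1, !![0, 2; 1, 0], !![0, 1; 2, 0], !![1, 2; 1, 1], !![1, 1; 2, 1], !![2, 2; 1, 2], !![2, 1; 2, 2],
      !![1, 0; 0, 2], !![2, 0; 0, 1], !![0, 1; 1, 0], !![0, 2; 2, 0], !![1, 1; 1, 2], !![1, 2; 2, 2], !![2, 1; 1, 1],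
      !![2, 2; 2, 1]} : Finset (Matrix (Fin 2) (Fin 2) (ZMod 3))).card ≤ 16 := by decide
  rw [Nat.card_eq_fintype_card, ← Finset.card_univ]
  exact h1.trans h2

/-- The involutions of `C_ns(3)` are `±1`. [folklore] -/
private theorem c_involution : ∀ a b : ZMod 3, (a, b) ≠ (0, 0) →
    (!![a, 2 * b; b, a] : Matrix (Fin 2) (Fin 2) (ZMod 3)) * !![a, 2 * b; b, a] = 1 →
    (!![a, 2 * b; b, a] : Matrix (Fin 2) (Fin 2) (ZMod 3)) = 1 ∨ (!![a, 2 * b; b, a] : Matrix (Fin 2) (Fin 2) (ZMod 3)) = -1 := by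
  decide

/-- The involutions of `C_ns⁺(3) ∖ C_ns(3)` are the four «reflections». [folklore] -/
private theorem n_involution : ∀ a b : ZMod 3, (a, b) ≠ (0, 0) →
    (!![a, -(2 * b); b, -a] : Matrix (Fin 2) (Fin 2) (ZMod 3)) * !![a, -(2 * b); b, -a] = 1 →
    (!![a, -(2 * b); b, -a] : Matrix (Fin 2) (Fin 2) (ZMod 3)) ∈
      ({!![1, 0; 0, 2], !![2, 0; 0, 1], !![0, 1; 1, 0], !![0, 2; 2, 0]} : Finset (Matrix (Fin 2) (Fin 2) (ZMod 3))) := by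
  decide

/-- For each reflection `S` and `R = (1 2; 1 1)` (order `8`): `S R² S = R⁶`, `R S = R⁶ S R`, `R² ≠ S`, `R² ≠ R⁴ S`; and
`R⁴ = −1`. [folklore] -/
private theorem reflection_facts : ∀ S ∈ ({!![1, 0; 0, 2], !![2, 0; 0, 1], !![0, 1; 1, 0], !![0, 2; 2, 0]} :
      Finset (Matrix (Fin 2) (Fin 2) (ZMod 3))),
    S * (!![1, 2; 1, 1] * !![1, 2; 1, 1]) * S =
        !![1, 2; 1, 1] * !![1, 2; 1, 1] * (!![1, 2; 1, 1] * !![1, 2; 1, 1]) * (!![1, 2; 1, 1] * !![1, 2; 1, 1]) ∧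
      (!![1, 2; 1, 1] : Matrix (Fin 2) (Fin 2) (ZMod 3)) * S =
        !![1, 2; 1, 1] * !![1, 2; 1, 1] * (!![1, 2; 1, 1] * !![1, 2; 1, 1]) * (!![1, 2; 1, 1] * !![1, 2; 1, 1]) * S *
          !![1, 2; 1, 1] ∧
      (!![1, 2; 1, 1] : Matrix (Fin 2) (Fin 2) (ZMod 3)) * !![1, 2; 1, 1] ≠ S ∧
      (!![1, 2; 1, 1] : Matrix (Fin 2) (Fin 2) (ZMod 3)) * !![1, 2; 1, 1] ≠
        !![1, 2; 1, 1] * !![1, 2; 1, 1] * (!![1, 2; 1, 1] * !![1, 2; 1, 1]) * S := by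
  decide

/-- `R⁴ = −1` for `R = (1 2; 1 1)`. [folklore] -/
private theorem R_pow_four : (!![1, 2; 1, 1] : Matrix (Fin 2) (Fin 2) (ZMod 3)) * !![1, 2; 1, 1] * (!![1, 2; 1, 1] * !![1, 2; 1, 1]) = -1 := by
  decide

/-- `R² = (0 1; 2 0)` for `R = (1 2; 1 1)`. [folklore] -/
private theorem R_sq : (!![1, 2; 1, 1] : Matrix (Fin 2) (Fin 2) (ZMod 3)) * !![1, 2; 1, 1] = !![0, 1; 2, 0] := by
  decide

/-- An element of the subgroup generated by an involution `t` is `1` or `t`. [folklore] -/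
private theorem eq_of_mem_zpowers_of_mul_self {G : Type*} [Group G] {t x : G} (ht : t * t = 1)
    (hx : x ∈ Subgroup.zpowers t) : x = 1 ∨ x = t := by
  have h2 : t ^ (2 : ℤ) = 1 := by rw [zpow_two]; exact ht
  obtain ⟨k, rfl⟩ := Subgroup.mem_zpowers_iff.mp hx
  rcases Int.emod_two_eq_zero_or_one k with hk | hk
  · left
    rw [← Int.mul_ediv_add_emod k 2, zpow_add, zpow_mul, h2, one_zpow, one_mul, hk, zpow_zero]
  · right
    rw [← Int.mul_ediv_add_emod k 2, zpow_add, zpow_mul, h2, one_zpow, one_mul, hk, zpow_one]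

/-- The non-squares of `𝔽₃`: only `2 = −1`. [folklore] -/
private theorem eq_two_of_not_isSquare {ε : ZMod 3} (hε : ¬ IsSquare ε) : ε = 2 := by
  have key : ∀ e : ZMod 3, e = 0 ∨ e = 1 ∨ e = 2 := by decide
  rcases key ε with h | h | h
  · exact absurd ⟨0, by rw [h, mul_zero]⟩ hε
  · exact absurd ⟨1, by rw [h, mul_one]⟩ hε
  · exact h

end Matrices

/-! ### §1 The semidihedral data of a faithful `C_ns⁺(3)`-valued representation -/

/-- From `ρ : G ↪ C_ns⁺(3)`, `r` with `ρ r = R` and an involution `s` with `ρ s ≠ ±1`: the `SD₁₆` relations for `w = r²`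
used by the census forms (`z = w²` central with `ρ z = −1`, `z² = 1 ≠ z`, `s w s⁻¹ = w⁻¹`, `w ∉ {s, zs}`, `r s r⁻¹ = w³ s`,
commutators in `⟨w⟩`) and `g⁸ = 1` for all `g`. [cite: Serre1972, §2.2 (non-split Cartan subgroups and their normalisers)] -/
private theorem semidihedral_data {G : Type*} [Group G] (ρ : G →* Matrix (Fin 2) (Fin 2) (ZMod 3))
    (hρ : Function.Injective ρ) (himg : ∀ g, ρ g ∈ nonsplitCartanNormalizer (2 : ZMod 3))
    {r : G} (hr : ρ r = !![1, 2; 1, 1]) {s : G} (hss : s * s = 1) (hs1 : ρ s ≠ 1) (hs2 : ρ s ≠ -1) :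
    ∃ w : G, ρ (w * w) = -1 ∧ (∀ g : G, g * (w * w) = (w * w) * g) ∧ (w * w) * (w * w) = 1 ∧ w * w ≠ 1 ∧
      s ≠ w * w ∧ s * w * s⁻¹ = w⁻¹ ∧ w ≠ s ∧ w ≠ w * w * s ∧ (∃ g : G, g * s * g⁻¹ = w * w * w * s) ∧
      (∀ a b : G, a * b * a⁻¹ * b⁻¹ ∈ Subgroup.zpowers w) := by
  obtain ⟨w, hw⟩ : ∃ w : G, w = r * r := ⟨_, rfl⟩
  have hρw : ρ w = !![1, 2; 1, 1] * !![1, 2; 1, 1] := by rw [hw, map_mul, hr]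
  have hρw' : ρ w = !![0, 1; 2, 0] := by rw [hρw, R_sq]
  have hρww : ρ (w * w) = -1 := by rw [map_mul, hρw, R_pow_four]
  have hzc : ∀ g : G, g * (w * w) = (w * w) * g := fun g =>
    hρ (by rw [map_mul ρ g (w * w), map_mul ρ (w * w) g, hρww, mul_neg, mul_one, neg_mul, one_mul])
  have hz4 : (w * w) * (w * w) = 1 := hρ (by rw [map_mul, hρww, neg_mul_neg, one_mul, map_one])
  have hz1 : w * w ≠ 1 := fun h => by
    have h' : ρ (w * w) = ρ 1 := by rw [h]
    rw [hρww, map_one] at h'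
    exact absurd h' (by decide)
  -- `ρ s` is one of the four reflections
  have hS : ρ s ∈ ({!![1, 0; 0, 2], !![2, 0; 0, 1], !![0, 1; 1, 0], !![0, 2; 2, 0]} :
      Finset (Matrix (Fin 2) (Fin 2) (ZMod 3))) := by
    have hSS : ρ s * ρ s = 1 := by rw [← map_mul, hss, map_one]
    obtain ⟨a, b, hab, h | h⟩ := himg s
    · rw [h] at hSS hs1 hs2
      rcases c_involution a b hab hSS with h' | h'
      exacts [absurd h' hs1, absurd h' hs2]
    · rw [h] at hSS ⊢
      exact n_involution a b hab hSS
  obtain ⟨hF1, hF2, hF3, hF4⟩ := reflection_facts (ρ s) hS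
  have hsinv : s⁻¹ = s := inv_eq_of_mul_eq_one_right hss
  have hwinv : w⁻¹ = w * w * w := inv_eq_of_mul_eq_one_right (by rw [← hz4]; group)
  refine ⟨w, hρww, hzc, hz4, hz1, fun h => hs2 (by rw [h, hρww]), ?_, fun h => hF3 (by rw [← hρw, ← h]),
    fun h => hF4 (by rw [← hρw, ← map_mul, ← map_mul, ← h]), ⟨r, ?_⟩, ?_⟩
  · rw [hsinv, hwinv]
    apply hρ
    simp only [map_mul, hρw]
    exact hF1
  · rw [mul_inv_eq_iff_eq_mul]
    apply hρ
    simp only [map_mul, hρw, hr]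
    exact hF2
  · intro a b
    rcases mul_eq_of_mem (himg a) (himg b) with h | h | h | h
    · have h2 : a * b = b * a := hρ (by rw [map_mul, map_mul, h])
      have h' : a * b * a⁻¹ * b⁻¹ = 1 := by rw [h2]; group
      rw [h']
      exact one_mem _
    · have h2 : a * b = w * w * (b * a) := hρ (by rw [map_mul, map_mul, h, hρww, map_mul ρ b a, neg_mul, one_mul])
      have h' : a * b * a⁻¹ * b⁻¹ = w ^ 2 := by rw [h2, pow_two]; group
      rw [h']
      exact Subgroup.npow_mem_zpowers w 2
    · have h2 : a * b = w * (b * a) := hρ (by rw [map_mul, map_mul, h, hρw', map_mul ρ b a])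
      have h' : a * b * a⁻¹ * b⁻¹ = w := by rw [h2]; group
      rw [h']
      exact Subgroup.mem_zpowers w
    · have h2 : a * b = w * w * w * (b * a) := hρ (by
        rw [map_mul, map_mul, h, map_mul ρ (w * w) w, hρww, hρw', map_mul ρ b a, neg_mul, one_mul, neg_mul])
      have h' : a * b * a⁻¹ * b⁻¹ = w ^ 3 := by rw [h2, pow_succ, pow_two]; group
      rw [h']
      exact Subgroup.npow_mem_zpowers w 3

/-! ### §2 The bridges -/

/-- Galois bookkeeping: `#G ≤ 16`, `[K:ℚ] = 8`, `1 ≠ s ∈ Gal(L/K)` give `s² = 1`, `K = L^{⟨s⟩}`, `#G = 16`. [cite: Washington1997, §13.1] -/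
private theorem fixingSubgroup_eq_zpowers_of_card {L : Type} [Field L] [NumberField L] [IsGalois ℚ L]
    (hG : Nat.card (L ≃ₐ[ℚ] L) ≤ 16) (K : IntermediateField ℚ L) (hK8 : Module.finrank ℚ ↥K = 8)
    {s : L ≃ₐ[ℚ] L} (hsK : s ∈ K.fixingSubgroup) (hs_ne : s ≠ 1) :
    s * s = 1 ∧ K = fixedField (Subgroup.zpowers s) ∧ Nat.card (L ≃ₐ[ℚ] L) = 16 := by
  have hgt : 1 < Nat.card ↥K.fixingSubgroup :=
    (Subgroup.one_lt_card_iff_ne_bot _).mpr fun h => hs_ne (by rw [h] at hsK; exact Subgroup.mem_bot.mp hsK)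
  have h1 : Nat.card ↥K.fixingSubgroup = Module.finrank ↥K L := IsGalois.card_fixingSubgroup_eq_finrank K
  have h2 : Module.finrank ℚ ↥K * Module.finrank ↥K L = Module.finrank ℚ L := Module.finrank_mul_finrank ℚ ↥K L
  have h3 : Nat.card (L ≃ₐ[ℚ] L) = Module.finrank ℚ L := IsGalois.card_aut_eq_finrank ℚ L
  rw [hK8] at h2
  have hHcard : Nat.card ↥K.fixingSubgroup = 2 := by omega
  have hss : s * s = 1 := by
    have h := pow_card_eq_one' (G := ↥K.fixingSubgroup) (x := ⟨s, hsK⟩)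
    rw [hHcard] at h
    have h' : s ^ 2 = 1 := by simpa using congrArg Subtype.val h
    rwa [pow_two] at h'
  have hKfix : K.fixingSubgroup = Subgroup.zpowers s := by
    symm
    apply Subgroup.eq_of_le_of_card_ge ((Subgroup.zpowers_le).mpr hsK)
    rw [hHcard, Nat.card_zpowers, orderOf_eq_prime (p := 2) (by rw [pow_two]; exact hss) hs_ne]
  refine ⟨hss, ?_, by omega⟩
  rw [← hKfix]; exact (IsGalois.fixedField_fixingSubgroup K).symm

/-- `3 ∤ [L : ℚ]` when `Gal(L/ℚ)` embeds in `C_ns⁺(3)` (orders divide `8`). [cite: Serre1972, §2.2] -/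
private theorem not_three_dvd_finrank (L : Type) [Field L] [NumberField L] [IsGalois ℚ L]
    (ρ : (L ≃ₐ[ℚ] L) →* Matrix (Fin 2) (Fin 2) (ZMod 3)) (hρ : Function.Injective ρ)
    (himg : ∀ g, ρ g ∈ nonsplitCartanNormalizer (2 : ZMod 3)) : ¬ 3 ∣ Module.finrank ℚ L := by
  rw [← IsGalois.card_aut_eq_finrank ℚ L]
  intro h3
  obtain ⟨g, hg⟩ := exists_prime_orderOf_dvd_card' 3 h3
  have h8 : g ^ 8 = 1 := hρ (by rw [map_pow, map_one]; exact pow_eight_eq_one_of_mem (himg g))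
  have hdvd : orderOf g ∣ 8 := orderOf_dvd_of_pow_eq_one h8
  rw [hg] at hdvd
  exact absurd hdvd (by decide)

/-- **`μ = 0` for the cyclotomic `ℤ_3`-tower of `L` from a faithful representation of `Gal(L/ℚ)` ONTO `C_ns⁺(3)` — fixed-field
form, modulo Ferrero–Washington alone.**  `L/ℚ` finite Galois; `ρ : Gal(L/ℚ) →* M₂(𝔽₃)` injective with `ρ(g) ∈ nonsplitCartanNormalizer ε`
(`ε` a non-square of `𝔽₃`) and every element of `C_ns⁺(ε)` attained; `s ∈ Gal(L/ℚ)` an involution with `ρ s ≠ ±1` and `z` with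
`ρ z = −1` (for `L = ℚ(E[3])` with `HasModPImageEqNonsplitCartanNormalizer E 3`: `L^{⟨s⟩} = ℚ(P)`, `L^{⟨s, z⟩} = ℚ(x(P))` when `s`
fixes `P`).  If `μ = 0` holds for every cyclotomic `ℤ_3`-extension of `L^{⟨s⟩}` and of `L^{⟨s⟩ ⊔ ⟨z⟩}`, then — under
`ferreroWashington1979_classicalMuVanishes` — for every cyclotomic `ℤ_3`-extension of `L` (`…_semidihedral_kuroda_rat` with `w = r²`,
`ρ r = (1 2; 1 1)`, `z = w²`). [cite: Serre1972, §2.2 (non-split Cartan subgroups and their normalisers)]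
[cite: FurioLombardo2023, (1.1)] [cite: Lemmermeyer1994, §1 (Kuroda's class number formula, odd part)] [cite: Washington1997, §7.5, §13.1] -/
theorem classicalMuVanishes_of_isCyclotomic_of_nonsplitCartanNormalizer_three_fixedField
    (hFW : ferreroWashington1979_classicalMuVanishes)
    (L : Type) [Field L] [NumberField L] [IsGalois ℚ L]
    (ρ : (L ≃ₐ[ℚ] L) →* Matrix (Fin 2) (Fin 2) (ZMod 3)) (hρ : Function.Injective ρ) {ε : ZMod 3} (hε : ¬ IsSquare ε)
    (himg : ∀ g, ρ g ∈ nonsplitCartanNormalizer ε) (hsurj : ∀ M ∈ nonsplitCartanNormalizer ε, ∃ g, ρ g = M)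
    {s : L ≃ₐ[ℚ] L} (hss : s * s = 1) (hs1 : ρ s ≠ 1) (hs2 : ρ s ≠ -1) {z : L ≃ₐ[ℚ] L} (hz : ρ z = -1)
    (hμ : ∀ κE : ZpExtension ↥(fixedField (Subgroup.zpowers s)) 3, κE.IsCyclotomic → ClassicalMuVanishes κE)
    (hμ' : ∀ κE : ZpExtension ↥(fixedField (Subgroup.zpowers s ⊔ Subgroup.zpowers z)) 3,
      κE.IsCyclotomic → ClassicalMuVanishes κE)
    (κL : ZpExtension L 3) (hκL : κL.IsCyclotomic) : ClassicalMuVanishes κL := by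
  obtain rfl := eq_two_of_not_isSquare hε
  obtain ⟨r, hr⟩ := hsurj !![1, 2; 1, 1] ⟨1, 1, by decide, Or.inl (by decide)⟩
  obtain ⟨w, hρww, hzc, hz4, -, -, hdih, -, -, hconj, hcomm⟩ := semidihedral_data ρ hρ himg hr hss hs1 hs2
  obtain rfl : z = w * w := hρ (by rw [hz, hρww])
  exact classicalMuVanishes_of_isCyclotomic_of_semidihedral_kuroda_rat hFW (by decide) L (not_three_dvd_finrank L ρ hρ himg) hzc
    hz4 hss hdih hconj hcomm hμ hμ' κL hκL

/-- **Fixed-field form with the input for `L^{⟨s⟩}` alone, paying Iwasawa's growth theorem** (`…_semidihedral_rat`).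
[cite: Serre1972, §2.2 (non-split Cartan subgroups and their normalisers)] [cite: Washington1997, §7.5, §13.1]
[cite: BiasseEtAl2022, Example 2.5, Prop. 3.7] -/
theorem classicalMuVanishes_of_isCyclotomic_of_nonsplitCartanNormalizer_three_fixedField'
    (hI : iwasawa1959_classNumberPExp_growth) (hFW : ferreroWashington1979_classicalMuVanishes)
    (L : Type) [Field L] [NumberField L] [IsGalois ℚ L]
    (ρ : (L ≃ₐ[ℚ] L) →* Matrix (Fin 2) (Fin 2) (ZMod 3)) (hρ : Function.Injective ρ) {ε : ZMod 3} (hε : ¬ IsSquare ε)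
    (himg : ∀ g, ρ g ∈ nonsplitCartanNormalizer ε) (hsurj : ∀ M ∈ nonsplitCartanNormalizer ε, ∃ g, ρ g = M)
    {s : L ≃ₐ[ℚ] L} (hss : s * s = 1) (hs1 : ρ s ≠ 1) (hs2 : ρ s ≠ -1)
    (hμ : ∀ κE : ZpExtension ↥(fixedField (Subgroup.zpowers s)) 3, κE.IsCyclotomic → ClassicalMuVanishes κE)
    (κL : ZpExtension L 3) (hκL : κL.IsCyclotomic) : ClassicalMuVanishes κL := by
  obtain rfl := eq_two_of_not_isSquare hε
  obtain ⟨r, hr⟩ := hsurj !![1, 2; 1, 1] ⟨1, 1, by decide, Or.inl (by decide)⟩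
  have hs_ne : s ≠ 1 := fun h => hs1 (by rw [h, map_one])
  obtain ⟨w, -, hzc, hz4, hz1, hsz, hdih, hws, hwzs, hconj, hcomm⟩ := semidihedral_data ρ hρ himg hr hss hs1 hs2
  exact classicalMuVanishes_of_isCyclotomic_of_semidihedral_rat hI hFW (by decide) L (not_three_dvd_finrank L ρ hρ himg) hzc hz4
    hz1 hss hs_ne hsz hdih hws hwzs hconj hcomm hμ κL hκL

/-- **Degree form.**  As `…_fixedField`, with `K ⊆ L` of degree `8` fixed by some `s` with `ρ s ≠ ±1` (`K = ℚ(P)`) and `K' ⊆ L`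
of degree `4` fixed by `s` and by every `g` with `ρ g = −1` (`K' = ℚ(x(P))`); `#Gal ≤ 16 = #C_ns⁺(3)` gives `s² = 1`, `K = L^{⟨s⟩}`,
`K' = L^{⟨s, −1⟩}`. [cite: Serre1972, §2.2] [cite: FurioLombardo2023, (1.1)] [cite: Lemmermeyer1994, §1] [cite: Washington1997, §13.1] -/
theorem classicalMuVanishes_of_isCyclotomic_of_nonsplitCartanNormalizer_three
    (hFW : ferreroWashington1979_classicalMuVanishes)
    (L : Type) [Field L] [NumberField L] [IsGalois ℚ L]
    (ρ : (L ≃ₐ[ℚ] L) →* Matrix (Fin 2) (Fin 2) (ZMod 3)) (hρ : Function.Injective ρ) {ε : ZMod 3} (hε : ¬ IsSquare ε)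
    (himg : ∀ g, ρ g ∈ nonsplitCartanNormalizer ε) (hsurj : ∀ M ∈ nonsplitCartanNormalizer ε, ∃ g, ρ g = M)
    (K : IntermediateField ℚ L) (hK8 : Module.finrank ℚ ↥K = 8)
    {s : L ≃ₐ[ℚ] L} (hsK : s ∈ K.fixingSubgroup) (hs1 : ρ s ≠ 1) (hs2 : ρ s ≠ -1)
    (K' : IntermediateField ℚ L) (hK'4 : Module.finrank ℚ ↥K' = 4) (hsK' : s ∈ K'.fixingSubgroup)
    (hzK' : ∀ g : L ≃ₐ[ℚ] L, ρ g = -1 → g ∈ K'.fixingSubgroup)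
    (hμ : ∀ κE : ZpExtension ↥K 3, κE.IsCyclotomic → ClassicalMuVanishes κE)
    (hμ' : ∀ κE : ZpExtension ↥K' 3, κE.IsCyclotomic → ClassicalMuVanishes κE)
    (κL : ZpExtension L 3) (hκL : κL.IsCyclotomic) : ClassicalMuVanishes κL := by
  have hε2 := eq_two_of_not_isSquare hε
  subst hε2
  obtain ⟨z, hz⟩ := hsurj (-1) ⟨2, 0, by decide, Or.inl (by decide)⟩
  have hs_ne : s ≠ 1 := fun h => hs1 (by rw [h, map_one])
  have hG := natCard_le_sixteen ρ hρ himg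
  obtain ⟨hss, hKeq, hG16⟩ := fixingSubgroup_eq_zpowers_of_card hG K hK8 hsK hs_ne
  have hzz : z * z = 1 := hρ (by rw [map_mul, hz, neg_mul_neg, one_mul, map_one])
  have hz1 : z ≠ 1 := fun h => by
    have h' : ρ z = ρ 1 := by rw [h]
    rw [hz, map_one] at h'
    exact absurd h' (by decide)
  have hsz : s ≠ z := fun h => hs2 (by rw [h, hz])
  -- `K' = L^{⟨s, z⟩}`
  have hK'eq : K' = fixedField (Subgroup.zpowers s ⊔ Subgroup.zpowers z) := by
    have hH : Nat.card ↥K'.fixingSubgroup = 4 := by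
      have h1 : Nat.card ↥K'.fixingSubgroup = Module.finrank ↥K' L := IsGalois.card_fixingSubgroup_eq_finrank K'
      have h2 : Module.finrank ℚ ↥K' * Module.finrank ↥K' L = Module.finrank ℚ L := Module.finrank_mul_finrank ℚ ↥K' L
      have h3 : Nat.card (L ≃ₐ[ℚ] L) = Module.finrank ℚ L := IsGalois.card_aut_eq_finrank ℚ L
      rw [hK'4] at h2
      omega
    have hle2 : Subgroup.zpowers s ⊔ Subgroup.zpowers z ≤ K'.fixingSubgroup :=
      sup_le ((Subgroup.zpowers_le).mpr hsK') ((Subgroup.zpowers_le).mpr (hzK' _ hz))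
    have hzcard : Nat.card ↥(Subgroup.zpowers z) = 2 := by
      rw [Nat.card_zpowers, orderOf_eq_prime (p := 2) (by rw [pow_two]; exact hzz) hz1]
    have hne : Subgroup.zpowers z ≠ Subgroup.zpowers s ⊔ Subgroup.zpowers z := by
      intro h
      have hs' : s ∈ Subgroup.zpowers z := by rw [h]; exact Subgroup.mem_sup_left (Subgroup.mem_zpowers s)
      rcases eq_of_mem_zpowers_of_mul_self hzz hs' with h' | h'
      exacts [hs_ne h', hsz h']
    have hdvd : Nat.card ↥(Subgroup.zpowers s ⊔ Subgroup.zpowers z) ∣ 2 ^ 2 := by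
      rw [show (2 : ℕ) ^ 2 = 4 by norm_num, ← hH]
      exact Subgroup.card_dvd_of_le hle2
    obtain ⟨i, hi, hcard⟩ := (Nat.dvd_prime_pow Nat.prime_two).mp hdvd
    have hgt : 2 < Nat.card ↥(Subgroup.zpowers s ⊔ Subgroup.zpowers z) := by
      by_contra hle
      push Not at hle
      exact hne (Subgroup.eq_of_le_of_card_ge le_sup_right (by rw [hzcard]; exact hle))
    have h4 : Nat.card ↥(Subgroup.zpowers s ⊔ Subgroup.zpowers z) = 4 := by
      interval_cases i
      · rw [hcard] at hgt; exact absurd hgt (by decide)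
      · rw [hcard] at hgt; exact absurd hgt (by decide)
      · rw [hcard]; norm_num
    have hHeq : Subgroup.zpowers s ⊔ Subgroup.zpowers z = K'.fixingSubgroup :=
      Subgroup.eq_of_le_of_card_ge hle2 (by rw [hH, h4])
    rw [hHeq]; exact (IsGalois.fixedField_fixingSubgroup K').symm
  -- transport the inputs and conclude
  have hμs : ∀ κE : ZpExtension ↥(fixedField (Subgroup.zpowers s)) 3, κE.IsCyclotomic → ClassicalMuVanishes κE :=
    forall_classicalMuVanishes_of_algEquiv (F := ℚ) (IntermediateField.equivOfEq hKeq) (by rw [hK8]; decide) hμ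
  have hμsz : ∀ κE : ZpExtension ↥(fixedField (Subgroup.zpowers s ⊔ Subgroup.zpowers z)) 3,
      κE.IsCyclotomic → ClassicalMuVanishes κE :=
    forall_classicalMuVanishes_of_algEquiv (F := ℚ) (IntermediateField.equivOfEq hK'eq) (by rw [hK'4]; decide) hμ'
  exact classicalMuVanishes_of_isCyclotomic_of_nonsplitCartanNormalizer_three_fixedField hFW L ρ hρ
    (by decide : ¬ IsSquare (2 : ZMod 3)) himg hsurj hss hs1 hs2 hz hμs hμsz κL hκL

/-- **Degree form with the octic input `ℚ(P)` alone, paying Iwasawa's growth theorem** (`…_semidihedral_rat`: `ℚ(x P) ⊆ ℚ(P)` has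
`3`-prime index). [cite: Serre1972, §2.2 (non-split Cartan subgroups and their normalisers)]
[cite: Washington1997, §7.5, §13.1] [cite: BiasseEtAl2022, Example 2.5, Prop. 3.7] -/
theorem classicalMuVanishes_of_isCyclotomic_of_nonsplitCartanNormalizer_three'
    (hI : iwasawa1959_classNumberPExp_growth) (hFW : ferreroWashington1979_classicalMuVanishes)
    (L : Type) [Field L] [NumberField L] [IsGalois ℚ L]
    (ρ : (L ≃ₐ[ℚ] L) →* Matrix (Fin 2) (Fin 2) (ZMod 3)) (hρ : Function.Injective ρ) {ε : ZMod 3} (hε : ¬ IsSquare ε)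
    (himg : ∀ g, ρ g ∈ nonsplitCartanNormalizer ε) (hsurj : ∀ M ∈ nonsplitCartanNormalizer ε, ∃ g, ρ g = M)
    (K : IntermediateField ℚ L) (hK8 : Module.finrank ℚ ↥K = 8)
    {s : L ≃ₐ[ℚ] L} (hsK : s ∈ K.fixingSubgroup) (hs1 : ρ s ≠ 1) (hs2 : ρ s ≠ -1)
    (hμ : ∀ κE : ZpExtension ↥K 3, κE.IsCyclotomic → ClassicalMuVanishes κE)
    (κL : ZpExtension L 3) (hκL : κL.IsCyclotomic) : ClassicalMuVanishes κL := by
  have hε2 := eq_two_of_not_isSquare hε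
  subst hε2
  have hs_ne : s ≠ 1 := fun h => hs1 (by rw [h, map_one])
  have hG := natCard_le_sixteen ρ hρ himg
  obtain ⟨hss, hKeq, -⟩ := fixingSubgroup_eq_zpowers_of_card hG K hK8 hsK hs_ne
  have hμs : ∀ κE : ZpExtension ↥(fixedField (Subgroup.zpowers s)) 3, κE.IsCyclotomic → ClassicalMuVanishes κE :=
    forall_classicalMuVanishes_of_algEquiv (F := ℚ) (IntermediateField.equivOfEq hKeq) (by rw [hK8]; decide) hμ
  exact classicalMuVanishes_of_isCyclotomic_of_nonsplitCartanNormalizer_three_fixedField' hI hFW L ρ hρ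
    (by decide : ¬ IsSquare (2 : ZMod 3)) himg hsurj hss hs1 hs2 hμs κL hκL

end Literature.NumberTheory.IwasawaTheory

end
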